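import Literature.MathematicalPhysics.QuantumFieldTheory.Balaban1983to89.B7Prop4GeneralInduction

/-!
# `Balaban1983to89.B7Prop4GaugeInductionRec` — [Balaban1985Averaging] PROPOSITION 4, THE k-UNIFORM INDUCTION (128)–(133) FOR THE RECORD's AVERAGING STRUCTURE ([Balaban1987RG1] (0.4)):
# the composition argument of pp. 37–38 WITH THE CARRIED COARSE GAUGE LETTER — abstract, structure-free, every constant symbolic (road (A′), director-ym №257∕№265∕№266)

statement-level skeleton of published theorems with citation tags; proofs where landed; nothing here is a claim about the Yang–Mills mass gap

CITATION HEADER (lean-in-tree rule).  Cell `pub-ymgap`, seat `pub-ymgap-dag-n05-e` g36 (N05-REC LEAD PEN); item R1 ([3] layer).  The record analogue of the engine's abstract induction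
`B7Prop4GeneralInduction.prop4_induction` (pub-balaban t4 NE7c leaf-10 g8, row S56), which it imports for the arithmetic (`step_key`, `geom` facts).  `--kind definition --supports
stmt-QuantumFields-20541` (K0⁷; count-neutral; three small abstract recursion `def`s + theorems).  Sources READ: [3] = [Balaban1985Averaging] pp. 37–38 (127)–(133), p. 31 (93), p. 36
(124)–(126) (`paper:balaban1985-cmp98-averaging`); [I] = [Balaban1987RG1] (0.4) p. 253; desk memos `HOME/pub-ymgap-dag-n05-e/LOCATED-N2-GENERAL-BACKGROUND.md`, `SOCKET-CHECK-N2.md`.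

WHY THIS FILE (the located point and its resolution, typed abstractly).  For the engine's structure the one-step linear part obeys (126) `|(Q(V₀)A)_c| ≤ (1 + O(1)L²α₀)|A|` with leading
coefficient EXACTLY `L`, and the products of the level factors stay `≤ e^{O(1)α₀}` — the k-uniformity of (128)∕(130)∕(131).  For the RECORD ([I] (0.4)) the one-step linear part is
`Λ_j = Q̂_j + D_{j+1}∘G_j` (`B7Prop3GaugeCarryRec`: `Q̂` obeys (126) verbatim; `G_j = λ` the carried letter, `D = d_{V̄}` the covariant coarse derivative), and `G_j` is NOT small in `sup|A|`
(`‖G_jA‖ ≤ g·|A|`, `g = 2dL`, no small factor: LOCATED-N2).  Multiplying `(1 + O(1))` per level would destroy k-uniformity.  IT DOES NOT: linearised averages map covariant pure gauges to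
covariant pure gauges — `Λ_j(D_jθ) = D_{j+1}(M_jθ)` with `M_j` the rotated tree-contour block mean, a sup-norm CONTRACTION ((93) linearised; `B7Prop3PureGaugeRec`) — so the gauge letters
ACCUMULATE ADDITIVELY along the levels instead of compounding: `Y_j = Ŷ_j + D_jΘ_j`, `Ŷ_{j+1} = Q̂_jŶ_j` (print's recursion, print's bound `∏(1+κ_i)·L^jb`), `Θ_{j+1} = M_jΘ_j + G_jŶ_j`
(`‖Θ_j‖ ≤ g·∏(1+κ_i)·L^jb` by the geometric sum over levels), and the same splitting for the (130) error.  Hence (128), (130), (131) hold FOR THE RECORD, k-UNIFORMLY, with print's constants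
multiplied by `(1 + 2g)`-type factors depending on `d, L` only — NO curvature hypothesis is needed for this.  (The finer statement that the carried letter is small in the CURVATURE — the
Stokes estimate `norm_lamZ_le` — is what the data step (1.56)–(1.57) of [Balaban1985RegularSpaces] consumes; it is not needed for the induction.)
WHAT IS PROVED (sorry-free; abstract: fields `σ → τ → 𝔸`, site functions `σ → 𝔸`, `𝔸` a seminormed group; per level `j` the data `F_j` (one-step map), `Q_j` (gauge-corrected linear part),
`G_j` (carried letter), `D_j` (covariant derivative at level `j`), `M_j` (block mean); hypotheses = Prop. 3's displays for `Q̂` + `‖G_jA‖ ≤ g|A|`, `‖D_jθ‖ ≤ 2|θ|`, `‖M_jθ‖ ≤ |θ|`, additivity,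
and the pure-gauge identity `Q_j(D_jθ) + D_{j+1}(G_j(D_jθ)) = D_{j+1}(M_jθ)`).  §1 the recursions `qhatIter` (Ŷ), `carryIter` (Θ, Ψ), `errIter` (Ê) and ★ the EXACT DECOMPOSITIONS
`linIter_eq_qhat_add_gauge` (`Y_j = Ŷ_j + D_jΘ_j`) and `err_eq_errIter_add_gauge` (`X_j − Y_j = Ê_j + D_jΨ_j`); §2 ★★★ `prop4_gauge_induction` — for every `j ≤ k`:
(126)_rec `‖Y_j‖ ≤ (1+2g)·∏_{i<j}(1+κ_i)·L^jb`; (130)_rec `‖X_j − Y_j‖ ≤ (1+2g)·2C₁K²·∏_{i<j}(1+κ_i)·(L^jb)²`, `K = 2(1+2g)`; (131)_rec `‖X_j‖ ≤ K·L^jb` — under print's smallness with `8C₁ ↦ 2C₁K²`: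
`∏(1+κ_i) ≤ P`, `P(1 + 2C₁K²·L^kb) ≤ 2`, `K·L^jb ≤ c₃`, `L ≥ 2`.  All constants symbolic; uniform in `k`.
HONEST SCOPE.  Abstract real-arithmetic induction; the hypotheses are DISCHARGED for the record's concrete objects by the sequel (`B7Prop4GeneralLevelsRec`: `Q̂ ↦ QhatZ`, `G ↦ lamZ`,
`D ↦` the covariant derivative, `M ↦ rlamZ`, (126) for `Q̂` = `B7Prop3GeneralLinearPdevRec`, the pure-gauge identity = `B7Prop3PureGaugeRec`, `g = 2dL` = `norm_lamZ_le_length`); nothing of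
[3]∕[6]∕[I] asserted; `HThm4Rec` UNDISCHARGED; N05 discharged of record untouched; N07 not claimable; counts unmoved (typed 28∕28 · discharged 8∕28); one finite 𝕋⁴ programme at fixed ε —
nothing continuum ∕ ℝ⁴ ∕ OS ∕ mass gap ∕ Clay.  Three abstract bookkeeping `def`s, no `instance`, no `notation`, no `sorry`.
-/

set_option autoImplicit false

noncomputable section

open scoped BigOperators
open Finset

namespace Literature.MathematicalPhysics.QuantumFieldTheory.Balaban1983to89.B7Prop4GaugeInductionRec

open B7Prop4GeneralInduction (step_key prod_one_add_le_exp_sum)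

/-! ## §0 Arithmetic of the level products -/

section Arithmetic

/-- the product of the level factors `1 + κ_i` is at least `1`. [cite: Balaban1985Averaging, (128) p.37 (bookkeeping)] -/
theorem one_le_prod_one_add (κ : ℕ → ℝ) (hκ : ∀ i, 0 ≤ κ i) :
    ∀ n : ℕ, 1 ≤ ∏ i ∈ range n, (1 + κ i)
  | 0 => by simp
  | n + 1 => by
    rw [prod_range_succ]
    have h1 := one_le_prod_one_add κ hκ n
    have h2 : 1 ≤ 1 + κ n := by linarith [hκ n]
    nlinarith

/-- the partial products are monotone in the number of levels. [cite: Balaban1985Averaging, (128) p.37 (bookkeeping)] -/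
theorem prod_one_add_mono (κ : ℕ → ℝ) (hκ : ∀ i, 0 ≤ κ i) {m n : ℕ} (h : m ≤ n) :
    ∏ i ∈ range m, (1 + κ i) ≤ ∏ i ∈ range n, (1 + κ i) := by
  induction n, h using Nat.le_induction with
  | base => exact le_rfl
  | succ n _ ih =>
    rw [prod_range_succ]
    have h1 := one_le_prod_one_add κ hκ n
    have h2 : 1 ≤ 1 + κ n := by linarith [hκ n]
    nlinarith

end Arithmetic

/-! ## §1 The recursions of the gauge decomposition and the exact splitting of the linear iterate and of the error -/

section Recursions

variable {σ τ 𝔸 : Type*} [SeminormedAddCommGroup 𝔸]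

/-- **`Ŷ` — the iterate of the GAUGE-CORRECTED linear parts**: `Ŷ₀ = B`, `Ŷ_{j+1} = Q̂_jŶ_j` (print's recursion «Q_{j+1}(U₀) = Q(Ū₀ʲ)Q_j(U₀)» for the part of the record's linearisation
that obeys (126)). [cite: Balaban1985Averaging, p.38 (before (133)), (126) p.36] -/
def qhatIter (Q : ℕ → (σ → τ → 𝔸) → σ → τ → 𝔸) (B : σ → τ → 𝔸) : ℕ → σ → τ → 𝔸
  | 0 => B
  | j + 1 => Q j (qhatIter Q B j)

/-- **The carried-letter recursion `Θ_{j+1} = M_jΘ_j + G_j(S_j)`**, `Θ₀ = 0`, driven by a sequence of fields `S` (the block mean `M_j` transports the letter already carried; the new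
letter `G_j(S_j)` is added — ADDITIVE accumulation along the levels). [cite: Balaban1985Averaging, (93) p.31, (124) p.36; Balaban1987RG1, (0.4) p.253] -/
def carryIter (M : ℕ → (σ → 𝔸) → σ → 𝔸) (G : ℕ → (σ → τ → 𝔸) → σ → 𝔸) (S : ℕ → σ → τ → 𝔸) : ℕ → σ → 𝔸
  | 0 => 0
  | j + 1 => M j (carryIter M G S j) + G j (S j)

/-- **`Ê` — the remainders (123) propagated by the gauge-corrected linear parts**: `Ê₀ = 0`, `Ê_{j+1} = R_j + Q̂_jÊ_j` (print's (132) recursion). [cite: Balaban1985Averaging, (132) p.38] -/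
def errIter (Q : ℕ → (σ → τ → 𝔸) → σ → τ → 𝔸) (R : ℕ → σ → τ → 𝔸) : ℕ → σ → τ → 𝔸
  | 0 => 0
  | j + 1 => R j + Q j (errIter Q R j)

variable (Q : ℕ → (σ → τ → 𝔸) → σ → τ → 𝔸) (G : ℕ → (σ → τ → 𝔸) → σ → 𝔸) (D : ℕ → (σ → 𝔸) → σ → τ → 𝔸)
  (M : ℕ → (σ → 𝔸) → σ → 𝔸)

omit [SeminormedAddCommGroup 𝔸] in
/-- `Ŷ₀ = B`. [cite: Balaban1985Averaging, (127) p.37] -/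
@[simp] theorem qhatIter_zero (B : σ → τ → 𝔸) : qhatIter Q B 0 = B := rfl

omit [SeminormedAddCommGroup 𝔸] in
/-- `Ŷ_{j+1} = Q̂_jŶ_j`. [cite: Balaban1985Averaging, p.38 (before (133))] -/
theorem qhatIter_succ (B : σ → τ → 𝔸) (j : ℕ) : qhatIter Q B (j + 1) = Q j (qhatIter Q B j) := rfl

/-- `Θ₀ = 0`. [cite: Balaban1985Averaging, (93) p.31] -/
@[simp] theorem carryIter_zero (S : ℕ → σ → τ → 𝔸) : carryIter M G S 0 = 0 := rfl

/-- `Θ_{j+1} = M_jΘ_j + G_j(S_j)`. [cite: Balaban1985Averaging, (93) p.31, (124) p.36] -/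
theorem carryIter_succ (S : ℕ → σ → τ → 𝔸) (j : ℕ) : carryIter M G S (j + 1) = M j (carryIter M G S j) + G j (S j) := rfl

/-- `Ê₀ = 0`. [cite: Balaban1985Averaging, (132) p.38] -/
@[simp] theorem errIter_zero (R : ℕ → σ → τ → 𝔸) : errIter Q R 0 = 0 := rfl

/-- `Ê_{j+1} = R_j + Q̂_jÊ_j`. [cite: Balaban1985Averaging, (132) p.38] -/
theorem errIter_succ (R : ℕ → σ → τ → 𝔸) (j : ℕ) : errIter Q R (j + 1) = R j + Q j (errIter Q R j) := rfl

omit [SeminormedAddCommGroup 𝔸] in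
/-- Additivity from the subtraction form used by the lineage's hypotheses. [cite: Balaban1985Averaging, (122) p.36 (bookkeeping)] -/
theorem map_add_of_map_sub {α β : Type*} [AddGroup α] [AddGroup β] {f : α → β} (h : ∀ a a', f (a - a') = f a - f a') (a a' : α) :
    f (a + a') = f a + f a' := by
  have := h (a + a') a'
  rw [add_sub_cancel_right] at this
  rw [this, sub_add_cancel]

variable {k : ℕ}
  (hQsub : ∀ j < k, ∀ A A' : σ → τ → 𝔸, Q j (A - A') = Q j A - Q j A')
  (hGsub : ∀ j < k, ∀ A A' : σ → τ → 𝔸, G j (A - A') = G j A - G j A')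
  (hDsub : ∀ j ≤ k, ∀ θ θ' : σ → 𝔸, D j (θ - θ') = D j θ - D j θ')
  (hgauge : ∀ j < k, ∀ θ : σ → 𝔸, Q j (D j θ) + D (j + 1) (G j (D j θ)) = D (j + 1) (M j θ))
include hQsub hGsub hDsub hgauge

/-- ★ **THE LINEAR ITERATE SPLITS EXACTLY: `Y_j = Ŷ_j + D_jΘ_j`** with `Θ = carryIter M G Ŷ` — because the full linear part `Λ_j = Q̂_j + D_{j+1}G_j` maps the covariant pure gauge
`D_jΘ_j` to the covariant pure gauge `D_{j+1}(M_jΘ_j)` ((93) linearised). [cite: Balaban1985Averaging, (93) p.31, (124) p.36, p.38 (before (133)); Balaban1987RG1, (0.4) p.253] -/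
theorem linIter_eq_qhat_add_gauge (B : σ → τ → 𝔸) (Y : ℕ → σ → τ → 𝔸) (hY0 : Y 0 = B)
    (hYs : ∀ j < k, Y (j + 1) = Q j (Y j) + D (j + 1) (G j (Y j))) :
    ∀ j ≤ k, Y j = qhatIter Q B j + D j (carryIter M G (qhatIter Q B) j) := by
  intro j
  induction j with
  | zero =>
    intro _
    have hD0 : D 0 (0 : σ → 𝔸) = 0 := by
      have := hDsub 0 (Nat.zero_le _) (0 : σ → 𝔸) 0
      rwa [sub_self, sub_self] at this
    rw [hY0, qhatIter_zero, carryIter_zero, hD0, add_zero]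
  | succ j ih =>
    intro hjk
    have hj : j < k := Nat.lt_of_succ_le hjk
    have h := ih hj.le
    rw [hYs j hj, h, qhatIter_succ, carryIter_succ, map_add_of_map_sub (hQsub j hj), map_add_of_map_sub (hGsub j hj),
      map_add_of_map_sub (hDsub (j + 1) hjk), map_add_of_map_sub (hDsub (j + 1) hjk), ← hgauge j hj]
    abel

/-- ★ **THE (130) ERROR SPLITS EXACTLY: `X_j − Y_j = Ê_j + D_jΨ_j`** with `R_j := F_jX_j − Λ_jX_j` (the one-step remainder (123) at the level-`j` field), `Ê = errIter Q̂ R`,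
`Ψ = carryIter M G Ê`. [cite: Balaban1985Averaging, (132) p.38, (123) p.36, (93) p.31] -/
theorem err_eq_errIter_add_gauge (B : σ → τ → 𝔸) (F : ℕ → (σ → τ → 𝔸) → σ → τ → 𝔸) (X Y : ℕ → σ → τ → 𝔸)
    (hX0 : X 0 = B) (hXs : ∀ j < k, X (j + 1) = F j (X j)) (hY0 : Y 0 = B)
    (hYs : ∀ j < k, Y (j + 1) = Q j (Y j) + D (j + 1) (G j (Y j))) :
    ∀ j ≤ k, X j - Y j
      = errIter Q (fun i => F i (X i) - (Q i (X i) + D (i + 1) (G i (X i)))) j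
        + D j (carryIter M G (errIter Q (fun i => F i (X i) - (Q i (X i) + D (i + 1) (G i (X i))))) j) := by
  intro j
  induction j with
  | zero =>
    intro _
    have hD0 : D 0 (0 : σ → 𝔸) = 0 := by
      have := hDsub 0 (Nat.zero_le _) (0 : σ → 𝔸) 0
      rwa [sub_self, sub_self] at this
    rw [hX0, hY0, sub_self, errIter_zero, carryIter_zero, hD0, add_zero]
  | succ j ih =>
    intro hjk
    have hj : j < k := Nat.lt_of_succ_le hjk
    have h := ih hj.le
    -- `X_j = Y_j + (Ê_j + D_jΨ_j)`, then expand `Λ_j` additively and use the pure-gauge identity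
    have hX : X j = Y j + (errIter Q (fun i => F i (X i) - (Q i (X i) + D (i + 1) (G i (X i)))) j
        + D j (carryIter M G (errIter Q (fun i => F i (X i) - (Q i (X i) + D (i + 1) (G i (X i))))) j)) := by
      rw [← h, add_sub_cancel]
    rw [hXs j hj, hYs j hj, errIter_succ, carryIter_succ, map_add_of_map_sub (hDsub (j + 1) hjk)]
    -- rewrite `Q_j(X_j)`, `G_j(X_j)` through the decomposition of `X_j`
    have hQX : Q j (X j) = Q j (Y j) + (Q j (errIter Q (fun i => F i (X i) - (Q i (X i) + D (i + 1) (G i (X i)))) j)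
        + Q j (D j (carryIter M G (errIter Q (fun i => F i (X i) - (Q i (X i) + D (i + 1) (G i (X i))))) j))) := by
      conv_lhs => rw [hX]
      rw [map_add_of_map_sub (hQsub j hj), map_add_of_map_sub (hQsub j hj)]
    have hGX : G j (X j) = G j (Y j) + (G j (errIter Q (fun i => F i (X i) - (Q i (X i) + D (i + 1) (G i (X i)))) j)
        + G j (D j (carryIter M G (errIter Q (fun i => F i (X i) - (Q i (X i) + D (i + 1) (G i (X i))))) j))) := by
      conv_lhs => rw [hX]
      rw [map_add_of_map_sub (hGsub j hj), map_add_of_map_sub (hGsub j hj)]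
    have hg := hgauge j hj (carryIter M G (errIter Q (fun i => F i (X i) - (Q i (X i) + D (i + 1) (G i (X i))))) j)
    -- assemble
    have hDadd := map_add_of_map_sub (hDsub (j + 1) hjk)
    rw [hQX, hGX, hDadd, hDadd]
    rw [← hg]
    abel

end Recursions

/-! ## §2 The k-uniform induction with the carried letter -/

section Induction

variable {σ τ 𝔸 : Type*} [SeminormedAddCommGroup 𝔸]

/-- ★★★ **PROPOSITION 4's INDUCTION (128)–(133) FOR THE RECORD's AVERAGING STRUCTURE, k-UNIFORM — from the one-step statement for `Q̂` plus the carried letter.**  Data per level `j < k`: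
the one-step map `F_j`, its linear part split as `Q̂_j + D_{j+1}∘G_j` (gauge-corrected part + covariant coarse derivative of the carried letter), the block mean `M_j`.  Hypotheses: (123) for
the remainder `F_j − (Q̂_j + D_{j+1}G_j)` (`C₁L²r²` for `sup|A| ≤ r ≤ c₃`); (126) FOR `Q̂` (`L(1+κ_j)r`); the TRIVIAL bound of the carried letter `‖G_jA‖ ≤ g·r` (no small factor); `‖D_jθ‖ ≤ 2m`,
`‖M_jθ‖ ≤ m` for `sup|θ| ≤ m`; additivity; the pure-gauge identity `Q̂_j(D_jθ) + D_{j+1}G_j(D_jθ) = D_{j+1}(M_jθ)`.  Smallness: `∏_{i<k}(1+κ_i) ≤ P`, `P(1 + 2C₁K²·L^kb) ≤ 2` with `K = 2(1+2g)`,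
`K·L^jb ≤ c₃` (`j < k`), `L ≥ 2`.  CONCLUSION for every `j ≤ k`: (126)_rec `‖Y_j‖ ≤ (1+2g)∏_{i<j}(1+κ_i)·L^jb`; (130)_rec `‖X_j − Y_j‖ ≤ (1+2g)·2C₁K²·∏_{i<j}(1+κ_i)·(L^jb)²`;
(131)_rec `‖X_j‖ ≤ K·L^jb`.  The gauge letters accumulate ADDITIVELY (`‖Θ_j‖ ≤ g∏(1+κ_i)L^jb`, `‖Ψ_j‖ ≤ g·2C₁K²∏(1+κ_i)(L^jb)²`), which is why print's constants change only by the factors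
`(1+2g)`, `K²∕4` and NOT by a power of `k`. [cite: Balaban1985Averaging, (128)–(133) pp.37–38, (93) p.31, (126) p.36; Balaban1987RG1, (0.4) p.253] -/
theorem prop4_gauge_induction {L C₁ c₃ b P g : ℝ} (hL : 2 ≤ L) (hC₁ : 0 ≤ C₁) (hg : 0 ≤ g) {k : ℕ}
    (κ : ℕ → ℝ) (hκ : ∀ j, 0 ≤ κ j)
    (F Q : ℕ → (σ → τ → 𝔸) → σ → τ → 𝔸) (G : ℕ → (σ → τ → 𝔸) → σ → 𝔸) (D : ℕ → (σ → 𝔸) → σ → τ → 𝔸)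
    (M : ℕ → (σ → 𝔸) → σ → 𝔸)
    (hQsub : ∀ j < k, ∀ A A' : σ → τ → 𝔸, Q j (A - A') = Q j A - Q j A')
    (hGsub : ∀ j < k, ∀ A A' : σ → τ → 𝔸, G j (A - A') = G j A - G j A')
    (hDsub : ∀ j ≤ k, ∀ θ θ' : σ → 𝔸, D j (θ - θ') = D j θ - D j θ')
    (hgauge : ∀ j < k, ∀ θ : σ → 𝔸, Q j (D j θ) + D (j + 1) (G j (D j θ)) = D (j + 1) (M j θ))
    (hrem : ∀ j < k, ∀ (A : σ → τ → 𝔸) (r : ℝ), 0 ≤ r → r ≤ c₃ → (∀ x y, ‖A x y‖ ≤ r) →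
      ∀ x y, ‖F j A x y - (Q j A x y + D (j + 1) (G j A) x y)‖ ≤ C₁ * L ^ 2 * r ^ 2)
    (hlin : ∀ j < k, ∀ (A : σ → τ → 𝔸) (r : ℝ), 0 ≤ r → (∀ x y, ‖A x y‖ ≤ r) → ∀ x y, ‖Q j A x y‖ ≤ L * (1 + κ j) * r)
    (hGn : ∀ j < k, ∀ (A : σ → τ → 𝔸) (r : ℝ), 0 ≤ r → (∀ x y, ‖A x y‖ ≤ r) → ∀ z, ‖G j A z‖ ≤ g * r)
    (hDn : ∀ j ≤ k, ∀ (θ : σ → 𝔸) (m : ℝ), 0 ≤ m → (∀ z, ‖θ z‖ ≤ m) → ∀ x y, ‖D j θ x y‖ ≤ 2 * m)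
    (hMn : ∀ j < k, ∀ (θ : σ → 𝔸) (m : ℝ), 0 ≤ m → (∀ z, ‖θ z‖ ≤ m) → ∀ z, ‖M j θ z‖ ≤ m)
    (B : σ → τ → 𝔸) (hb : 0 ≤ b) (hB : ∀ x y, ‖B x y‖ ≤ b)
    (X Y : ℕ → σ → τ → 𝔸) (hX0 : X 0 = B) (hXs : ∀ j < k, X (j + 1) = F j (X j))
    (hY0 : Y 0 = B) (hYs : ∀ j < k, Y (j + 1) = Q j (Y j) + D (j + 1) (G j (Y j)))
    (hP : ∏ i ∈ range k, (1 + κ i) ≤ P)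
    (hsmall : P * (1 + 2 * C₁ * (2 * (1 + 2 * g)) ^ 2 * (L ^ k * b)) ≤ 2)
    (hc₃ : ∀ j < k, (2 * (1 + 2 * g)) * (L ^ j * b) ≤ c₃) :
    ∀ j ≤ k,
      (∀ x y, ‖Y j x y‖ ≤ (1 + 2 * g) * (∏ i ∈ range j, (1 + κ i)) * (L ^ j * b)) ∧
      (∀ x y, ‖X j x y - Y j x y‖ ≤ (1 + 2 * g) * (2 * C₁ * (2 * (1 + 2 * g)) ^ 2) * (∏ i ∈ range j, (1 + κ i)) * (L ^ j * b) ^ 2) ∧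
      (∀ x y, ‖X j x y‖ ≤ (2 * (1 + 2 * g)) * (L ^ j * b)) := by
  -- names
  set K : ℝ := 2 * (1 + 2 * g) with hK
  obtain ⟨R, hR⟩ : ∃ R : ℕ → σ → τ → 𝔸, R = fun i => F i (X i) - (Q i (X i) + D (i + 1) (G i (X i))) := ⟨_, rfl⟩
  have hRpt : ∀ j x y, R j x y = F j (X j) x y - (Q j (X j) x y + D (j + 1) (G j (X j)) x y) := by
    intro j x y; rw [hR]; rfl
  have hL1 : (1 : ℝ) ≤ L := by linarith
  have hL0 : (0 : ℝ) ≤ L := by linarith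
  have hg1 : 0 ≤ 1 + 2 * g := by positivity
  have hK0 : 0 ≤ K := by rw [hK]; positivity
  have hK1 : 1 ≤ K := by rw [hK]; nlinarith
  have hP1 : ∀ j, 1 ≤ ∏ i ∈ range j, (1 + κ i) := one_le_prod_one_add κ hκ
  have hsplitY := linIter_eq_qhat_add_gauge Q G D M hQsub hGsub hDsub hgauge B Y hY0 hYs
  have hsplitE : ∀ j ≤ k, X j - Y j = errIter Q R j + D j (carryIter M G (errIter Q R) j) := by
    rw [hR]; exact err_eq_errIter_add_gauge Q G D M hQsub hGsub hDsub hgauge B F X Y hX0 hXs hY0 hYs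
  -- the simultaneous induction on the four auxiliary sequences and `X`
  have main : ∀ j ≤ k,
      (∀ x y, ‖qhatIter Q B j x y‖ ≤ (∏ i ∈ range j, (1 + κ i)) * (L ^ j * b)) ∧
      (∀ z, ‖carryIter M G (qhatIter Q B) j z‖ ≤ g * ((∏ i ∈ range j, (1 + κ i)) * (L ^ j * b))) ∧
      (∀ x y, ‖errIter Q R j x y‖ ≤ 2 * C₁ * K ^ 2 * (∏ i ∈ range j, (1 + κ i)) * (L ^ j * b) ^ 2) ∧
      (∀ z, ‖carryIter M G (errIter Q R) j z‖ ≤ g * (2 * C₁ * K ^ 2 * (∏ i ∈ range j, (1 + κ i)) * (L ^ j * b) ^ 2)) ∧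
      (∀ x y, ‖X j x y‖ ≤ K * (L ^ j * b)) := by
    intro j
    induction j with
    | zero =>
      intro _
      refine ⟨fun x y => ?_, fun z => ?_, fun x y => ?_, fun z => ?_, fun x y => ?_⟩
      · rw [qhatIter_zero, prod_range_zero, pow_zero, one_mul, one_mul]; exact hB x y
      · rw [carryIter_zero, Pi.zero_apply, norm_zero]; positivity
      · rw [errIter_zero, Pi.zero_apply, Pi.zero_apply, norm_zero]; positivity
      · rw [carryIter_zero, Pi.zero_apply, norm_zero]; positivity
      · rw [hX0, pow_zero, one_mul]; nlinarith [hB x y, norm_nonneg (B x y)]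
    | succ j ih =>
      intro hjk
      have hj : j < k := Nat.lt_of_succ_le hjk
      obtain ⟨hYb, hΘb, hEb, hΨb, hXb⟩ := ih hj.le
      -- abbreviations for the level-j size and product (plain reals)
      obtain ⟨t, ht⟩ : ∃ t : ℝ, t = L ^ j * b := ⟨_, rfl⟩
      obtain ⟨Pj, hPj⟩ : ∃ Pj : ℝ, Pj = ∏ i ∈ range j, (1 + κ i) := ⟨_, rfl⟩
      rw [← ht] at hXb
      rw [← ht, ← hPj] at hYb hΘb hEb hΨb
      have ht0 : 0 ≤ t := by rw [ht]; positivity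
      have hPj1 : 1 ≤ Pj := by rw [hPj]; exact hP1 j
      have hPj0 : 0 ≤ Pj := by linarith
      have hκj := hκ j
      have hPsucc : ∏ i ∈ range (j + 1), (1 + κ i) = Pj * (1 + κ j) := by rw [hPj]; exact prod_range_succ _ _
      have hP'1 : 1 ≤ Pj * (1 + κ j) := by nlinarith
      have hP'0 : 0 ≤ Pj * (1 + κ j) := by linarith
      have htL : L ^ (j + 1) * b = L * t := by rw [ht, pow_succ]; ring
      -- Ŷ_{j+1}
      have hYb' : ∀ x y, ‖qhatIter Q B (j + 1) x y‖ ≤ Pj * (1 + κ j) * (L * t) := by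
        intro x y
        rw [qhatIter_succ]
        calc ‖Q j (qhatIter Q B j) x y‖ ≤ L * (1 + κ j) * (Pj * t) := hlin j hj _ _ (by positivity) hYb x y
          _ = Pj * (1 + κ j) * (L * t) := by ring
      -- Θ_{j+1}
      have hΘb' : ∀ z, ‖carryIter M G (qhatIter Q B) (j + 1) z‖ ≤ g * (Pj * (1 + κ j) * (L * t)) := by
        intro z
        rw [carryIter_succ, Pi.add_apply]
        have h1 := hMn j hj _ _ (by positivity) hΘb z
        have h2 := hGn j hj _ _ (by positivity) hYb z
        have h0 : 0 ≤ g * Pj * t := by positivity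
        have h22 : (2 : ℝ) ≤ L * (1 + κ j) := by nlinarith
        calc ‖M j (carryIter M G (qhatIter Q B) j) z + G j (qhatIter Q B j) z‖ ≤ g * (Pj * t) + g * (Pj * t) :=
              (norm_add_le _ _).trans (add_le_add h1 h2)
          _ = g * Pj * t * 2 := by ring
          _ ≤ g * Pj * t * (L * (1 + κ j)) := mul_le_mul_of_nonneg_left h22 h0
          _ = g * (Pj * (1 + κ j) * (L * t)) := by ring
      -- the remainder at level j (Prop. 3 applies: sup‖X_j‖ ≤ Kt ≤ c₃)
      have hKt : K * t ≤ c₃ := by rw [hK, ht]; exact hc₃ j hj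
      have hRb : ∀ x y, ‖R j x y‖ ≤ C₁ * L ^ 2 * (K * t) ^ 2 := by
        intro x y
        rw [hRpt]
        exact hrem j hj (X j) (K * t) (by positivity) hKt hXb x y
      -- Ê_{j+1}
      have hEb' : ∀ x y, ‖errIter Q R (j + 1) x y‖ ≤ 2 * C₁ * K ^ 2 * (Pj * (1 + κ j)) * (L * t) ^ 2 := by
        intro x y
        rw [errIter_succ, Pi.add_apply, Pi.add_apply]
        have h2 : ‖Q j (errIter Q R j) x y‖ ≤ L * (1 + κ j) * (2 * C₁ * K ^ 2 * Pj * t ^ 2) :=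
          hlin j hj _ _ (by positivity) hEb x y
        have hkey := step_key (t := K / 2 * t) hL hC₁ hP'1
        calc ‖R j x y + Q j (errIter Q R j) x y‖ ≤ C₁ * L ^ 2 * (K * t) ^ 2 + L * (1 + κ j) * (2 * C₁ * K ^ 2 * Pj * t ^ 2) :=
              (norm_add_le _ _).trans (add_le_add (hRb x y) h2)
          _ = C₁ * L ^ 2 * (2 * (K / 2 * t)) ^ 2 + L * (1 * (Pj * (1 + κ j))) * (8 * C₁ * (K / 2 * t) ^ 2) := by ring
          _ ≤ 8 * C₁ * (Pj * (1 + κ j)) * (L * (K / 2 * t)) ^ 2 := hkey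
          _ = 2 * C₁ * K ^ 2 * (Pj * (1 + κ j)) * (L * t) ^ 2 := by ring
      -- Ψ_{j+1}
      have hΨb' : ∀ z, ‖carryIter M G (errIter Q R) (j + 1) z‖ ≤ g * (2 * C₁ * K ^ 2 * (Pj * (1 + κ j)) * (L * t) ^ 2) := by
        intro z
        rw [carryIter_succ, Pi.add_apply]
        have h1 := hMn j hj _ _ (by positivity) hΨb z
        have h2 := hGn j hj _ _ (by positivity) hEb z
        have h0 : 0 ≤ g * (2 * C₁ * K ^ 2 * Pj * t ^ 2) := by positivity
        have h22 : (2 : ℝ) ≤ L ^ 2 * (1 + κ j) := by nlinarith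
        calc ‖M j (carryIter M G (errIter Q R) j) z + G j (errIter Q R j) z‖
            ≤ g * (2 * C₁ * K ^ 2 * Pj * t ^ 2) + g * (2 * C₁ * K ^ 2 * Pj * t ^ 2) := (norm_add_le _ _).trans (add_le_add h1 h2)
          _ = g * (2 * C₁ * K ^ 2 * Pj * t ^ 2) * 2 := by ring
          _ ≤ g * (2 * C₁ * K ^ 2 * Pj * t ^ 2) * (L ^ 2 * (1 + κ j)) := mul_le_mul_of_nonneg_left h22 h0
          _ = g * (2 * C₁ * K ^ 2 * (Pj * (1 + κ j)) * (L * t) ^ 2) := by ring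
      -- X_{j+1} through the two decompositions
      have hXb' : ∀ x y, ‖X (j + 1) x y‖ ≤ K * (L * t) := by
        intro x y
        have hY : ‖Y (j + 1) x y‖ ≤ (1 + 2 * g) * (Pj * (1 + κ j) * (L * t)) := by
          rw [hsplitY (j + 1) hjk, Pi.add_apply, Pi.add_apply]
          have hD := hDn (j + 1) hjk _ _ (by positivity) hΘb' x y
          calc ‖qhatIter Q B (j + 1) x y + D (j + 1) (carryIter M G (qhatIter Q B) (j + 1)) x y‖
              ≤ Pj * (1 + κ j) * (L * t) + 2 * (g * (Pj * (1 + κ j) * (L * t))) := (norm_add_le _ _).trans (add_le_add (hYb' x y) hD)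
            _ = (1 + 2 * g) * (Pj * (1 + κ j) * (L * t)) := by ring
        have hE : ‖X (j + 1) x y - Y (j + 1) x y‖ ≤ (1 + 2 * g) * (2 * C₁ * K ^ 2 * (Pj * (1 + κ j)) * (L * t) ^ 2) := by
          have h := congrFun (congrFun (hsplitE (j + 1) hjk) x) y
          simp only [Pi.sub_apply, Pi.add_apply] at h
          rw [h]
          have hD := hDn (j + 1) hjk _ _ (by positivity) hΨb' x y
          calc ‖errIter Q R (j + 1) x y + D (j + 1) (carryIter M G (errIter Q R) (j + 1)) x y‖
              ≤ 2 * C₁ * K ^ 2 * (Pj * (1 + κ j)) * (L * t) ^ 2 + 2 * (g * (2 * C₁ * K ^ 2 * (Pj * (1 + κ j)) * (L * t) ^ 2)) :=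
                (norm_add_le _ _).trans (add_le_add (hEb' x y) hD)
            _ = (1 + 2 * g) * (2 * C₁ * K ^ 2 * (Pj * (1 + κ j)) * (L * t) ^ 2) := by ring
        have hP'le : Pj * (1 + κ j) ≤ P := by rw [← hPsucc]; exact (prod_one_add_mono κ hκ hjk).trans hP
        have hLt_le : L * t ≤ L ^ k * b := by
          rw [← htL]; exact mul_le_mul_of_nonneg_right (pow_le_pow_right₀ hL1 hjk) hb
        have hLt0 : 0 ≤ L * t := by positivity
        have hsum : ‖X (j + 1) x y‖ ≤ (1 + 2 * g) * (Pj * (1 + κ j) * (L * t)) + (1 + 2 * g) * (2 * C₁ * K ^ 2 * (Pj * (1 + κ j)) * (L * t) ^ 2) := by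
          have h := norm_add_le (Y (j + 1) x y) (X (j + 1) x y - Y (j + 1) x y)
          rw [add_sub_cancel] at h
          exact h.trans (add_le_add hY hE)
        have hC2 : 0 ≤ 2 * C₁ * K ^ 2 := by positivity
        have hbr : Pj * (1 + κ j) * (1 + 2 * C₁ * K ^ 2 * (L * t)) ≤ 2 := by
          have h1 : 1 + 2 * C₁ * K ^ 2 * (L * t) ≤ 1 + 2 * C₁ * K ^ 2 * (L ^ k * b) := by
            have := mul_le_mul_of_nonneg_left hLt_le hC2
            linarith
          have h2 : 0 ≤ 1 + 2 * C₁ * K ^ 2 * (L * t) := by positivity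
          calc Pj * (1 + κ j) * (1 + 2 * C₁ * K ^ 2 * (L * t)) ≤ P * (1 + 2 * C₁ * K ^ 2 * (L ^ k * b)) := mul_le_mul hP'le h1 h2 (by linarith)
            _ ≤ 2 := by rw [hK]; exact hsmall
        have hfin : (1 + 2 * g) * (Pj * (1 + κ j) * (L * t)) + (1 + 2 * g) * (2 * C₁ * K ^ 2 * (Pj * (1 + κ j)) * (L * t) ^ 2) ≤ K * (L * t) := by
          have e : (1 + 2 * g) * (Pj * (1 + κ j) * (L * t)) + (1 + 2 * g) * (2 * C₁ * K ^ 2 * (Pj * (1 + κ j)) * (L * t) ^ 2)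
              = ((1 + 2 * g) * (L * t)) * (Pj * (1 + κ j) * (1 + 2 * C₁ * K ^ 2 * (L * t))) := by ring
          rw [e]
          have h0 : 0 ≤ (1 + 2 * g) * (L * t) := by positivity
          calc ((1 + 2 * g) * (L * t)) * (Pj * (1 + κ j) * (1 + 2 * C₁ * K ^ 2 * (L * t))) ≤ ((1 + 2 * g) * (L * t)) * 2 :=
                mul_le_mul_of_nonneg_left hbr h0
            _ = K * (L * t) := by rw [hK]; ring
        exact hsum.trans hfin
      rw [hPsucc, htL]
      exact ⟨hYb', hΘb', hEb', hΨb', hXb'⟩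
  -- conclusions through the decompositions
  intro j hj
  obtain ⟨hYb, hΘb, hEb, hΨb, hXb⟩ := main j hj
  refine ⟨fun x y => ?_, fun x y => ?_, fun x y => hXb x y⟩
  · rw [hsplitY j hj, Pi.add_apply, Pi.add_apply]
    have hm : 0 ≤ g * ((∏ i ∈ range j, (1 + κ i)) * (L ^ j * b)) := by
      have := hP1 j; positivity
    have hD := hDn j hj _ _ hm hΘb x y
    calc ‖qhatIter Q B j x y + D j (carryIter M G (qhatIter Q B) j) x y‖
        ≤ (∏ i ∈ range j, (1 + κ i)) * (L ^ j * b) + 2 * (g * ((∏ i ∈ range j, (1 + κ i)) * (L ^ j * b))) :=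
          (norm_add_le _ _).trans (add_le_add (hYb x y) hD)
      _ = (1 + 2 * g) * (∏ i ∈ range j, (1 + κ i)) * (L ^ j * b) := by ring
  · have h := congrFun (congrFun (hsplitE j hj) x) y
    simp only [Pi.sub_apply, Pi.add_apply] at h
    rw [h]
    have hm : 0 ≤ g * (2 * C₁ * K ^ 2 * (∏ i ∈ range j, (1 + κ i)) * (L ^ j * b) ^ 2) := by
      have := hP1 j; positivity
    have hD := hDn j hj _ _ hm hΨb x y
    calc ‖errIter Q R j x y + D j (carryIter M G (errIter Q R) j) x y‖
        ≤ 2 * C₁ * K ^ 2 * (∏ i ∈ range j, (1 + κ i)) * (L ^ j * b) ^ 2 + 2 * (g * (2 * C₁ * K ^ 2 * (∏ i ∈ range j, (1 + κ i)) * (L ^ j * b) ^ 2)) :=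
          (norm_add_le _ _).trans (add_le_add (hEb x y) hD)
      _ = (1 + 2 * g) * (2 * C₁ * K ^ 2) * (∏ i ∈ range j, (1 + κ i)) * (L ^ j * b) ^ 2 := by ring

end Induction

end Literature.MathematicalPhysics.QuantumFieldTheory.Balaban1983to89.B7Prop4GaugeInductionRec
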